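import Literature.Geometry.Lorentzian.MultiCentreRadiationZone
import Literature.Geometry.Lorentzian.KerrConvergenceProofs
import HarnessLib

/-!
# Route EIHFluxBalance — crux `ModulatedKerrHandoff` (stmt-FinalStateConjecture-10167): stub `stub_deviationTransfer`

Line `photon-rocket-modulation` (Cruxes/ModulatedKerrHandoff/Lines/…), registered stub S3b
(DEVIATION TRANSFER, abstract bookkeeping), proved here verbatim (name + signature).

**Statement.** For any spacetime `𝓢`, open `U ⊆ E4`, smooth chart map `Φ : U → 𝓢` and two
reference fields `b, b' : E4 → (E4 →L E4 →L ℝ)` on the SAME domain `U` (lab time `x⁰`, radius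
`|x̲|`): if `b'` is `C^∞` at every point of `U`, `b` is `C^∞` at every point of `U` with `x⁰ > T`,
and `D^{≤3}(b − b') → 0` both unweighted on the `U`-slabs `{x⁰ = t}` and `w`-weighted on the cone
slabs `{x⁰ = t, |x̲| ≤ κt}` (any weight `w : ℝ → E4 → ℝ≥0∞`), then the unweighted `C³` deviation
clause (`Spacetime.deviationCk … 3 t → 0`) and the `w`-weighted cone clause transfer from the
background `⟨U, b, x⁰, |x̲|⟩` to `⟨U, b', x⁰, |x̲|⟩`.

**Proof.** On `U`, `Φ^* g − b' = (Φ^* g − b) + (b − b')` pointwise (`Spacetime.deviationExtend_coe`,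
`Spacetime.deviation_eq_pullback_sub`: the pullback term `Φ^* g` is the same for both backgrounds,
which share the domain and the chart map), hence as an eventual equality near each point of the
open set `U`; at late points of `U` both `Φ^* g − b` (`Spacetime.contDiffAt_deviationExtend_model`)
and `b − b'` are `C^∞`, so `‖D^m (Φ^* g − b')‖ₑ ≤ ‖D^m (Φ^* g − b)‖ₑ + ‖D^m (b − b')‖ₑ` there
(`Filter.EventuallyEq.iteratedFDeriv`, `enorm_iteratedFDeriv_add_le`); multiply by the weight,
take sups over the slabs (`deviationCk = supCkENorm` over `Subtype.val '' timeSlab`) and squeeze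
(`tendsto_of_tendsto_of_tendsto_of_le_of_le'`). No field equations, no decay rates: pure locality
and subadditivity of `iteratedFDeriv`. [folklore]
-/

noncomputable section

open scoped Manifold ContDiff Topology ENNReal
open Filter Set TopologicalSpace Literature.Geometry.Lorentzian

namespace Summit.FinalStateConjecture.FinalStateConjecture.Cruxes.ModulatedKerrHandoff.PhotonRocketModulation

variable (𝓢 : Spacetime.{0} 4)

/-! ### Two reference fields on one domain -/

/-- Pointwise identity on the common domain: the deviations of one chart map from two reference
fields `b, b'` on the same domain differ by `b − b'`, `(Φ^* g − b') = (Φ^* g − b) + (b − b')`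
(the pullback term is literally the same). [folklore] -/
theorem deviationTransfer_deviation_eq (U : Opens E4) (Φ : U → 𝓢.carrier)
    (b b' : E4 → E4 →L[ℝ] E4 →L[ℝ] ℝ) (tf rf : E4 → ℝ) (x : U) :
    𝓢.deviation (ModelBackground.mk U b' tf rf) Φ x =
      𝓢.deviation (ModelBackground.mk U b tf rf) Φ x + (b x.1 - b' x.1) := by
  rw [Spacetime.deviation_eq_pullback_sub, Spacetime.deviation_eq_pullback_sub]
  exact (sub_add_sub_cancel _ (b x.1) _).symm

/-- Extended-by-zero form of `deviationTransfer_deviation_eq`, as an eventual equality near a point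
of the open domain `U`: `deviationExtend ⟨U, b'⟩ Φ = deviationExtend ⟨U, b⟩ Φ + (b − b')` near
`z ∈ U`. [folklore] -/
theorem deviationTransfer_eventuallyEq (U : Opens E4) (Φ : U → 𝓢.carrier)
    (b b' : E4 → E4 →L[ℝ] E4 →L[ℝ] ℝ) (tf rf : E4 → ℝ) {z : E4} (hz : z ∈ U) :
    𝓢.deviationExtend (ModelBackground.mk U b' tf rf) Φ =ᶠ[𝓝 z]
      fun y ↦ 𝓢.deviationExtend (ModelBackground.mk U b tf rf) Φ y + (b y - b' y) := by
  filter_upwards [U.2.mem_nhds hz] with y hy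
  have e1 := 𝓢.deviationExtend_coe (ModelBackground.mk U b' tf rf) Φ ⟨y, hy⟩
  have e2 := 𝓢.deviationExtend_coe (ModelBackground.mk U b tf rf) Φ ⟨y, hy⟩
  exact e1.trans ((deviationTransfer_deviation_eq 𝓢 U Φ b b' tf rf ⟨y, hy⟩).trans
    (congrArg (· + (b y - b' y)) e2.symm))

/-- At a point of `U` where both reference fields are `C^∞` (so that both `Φ^* g − b`, by
`Spacetime.contDiffAt_deviationExtend_model`, and `b − b'` are):
`‖D^m (Φ^* g − b')‖ₑ ≤ ‖D^m (Φ^* g − b)‖ₑ + ‖D^m (b − b')‖ₑ` (locality and subadditivity of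
`iteratedFDeriv`). [folklore] -/
theorem deviationTransfer_enorm_iteratedFDeriv_le (U : Opens E4) {Φ : U → 𝓢.carrier}
    (hΦ : ContMDiff 𝓘(ℝ, E4) (𝓡 4) ∞ Φ) (b b' : E4 → E4 →L[ℝ] E4 →L[ℝ] ℝ) (tf rf : E4 → ℝ)
    (x : U) (hbx : ContDiffAt ℝ ∞ b x.1) (hb'x : ContDiffAt ℝ ∞ b' x.1) (m : ℕ) :
    ‖iteratedFDeriv ℝ m (𝓢.deviationExtend (ModelBackground.mk U b' tf rf) Φ) x.1‖ₑ ≤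
      ‖iteratedFDeriv ℝ m (𝓢.deviationExtend (ModelBackground.mk U b tf rf) Φ) x.1‖ₑ +
        ‖iteratedFDeriv ℝ m (fun y ↦ b y - b' y) x.1‖ₑ := by
  have h1 : ContDiffAt ℝ m (𝓢.deviationExtend (ModelBackground.mk U b tf rf) Φ) x.1 :=
    (𝓢.contDiffAt_deviationExtend_model (ModelBackground.mk U b tf rf) hΦ x hbx).of_le
      (by exact_mod_cast le_top)
  have h2 : ContDiffAt ℝ m (fun y ↦ b y - b' y) x.1 :=
    (hbx.sub hb'x).of_le (by exact_mod_cast le_top)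
  rw [((deviationTransfer_eventuallyEq 𝓢 U Φ b b' tf rf x.2).iteratedFDeriv ℝ m).eq_of_nhds]
  exact enorm_iteratedFDeriv_add_le h1 h2

/-! ### The registered stub -/

/-- S3b · DEVIATION TRANSFER (registered stub of line `photon-rocket-modulation`, crux
`EIHFluxBalance.ModulatedKerrHandoff`). For ANY spacetime `𝓢`, open `U ⊆ E4`, smooth chart map
`Φ : U → 𝓢`, and two reference fields `b, b' : E4 → (E4 →L E4 →L ℝ)` on the SAME domain with lab
time `x⁰` and radius `|x̲|`: if `b'` is `C^∞` at every point of `U`, `b` is `C^∞` at every point of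
`U` with `x⁰ > T`, and the difference `b − b'` has `sup_{U-slab t} ‖D^m(b − b')‖ → 0` and
`sup_{cone slab t} w·‖D^m(b − b')‖ → 0` (`m ≤ 3`, any weight `w : ℝ → E4 → ℝ≥0∞`), then the
unweighted `C³` deviation clause and the `w`-weighted cone clause transfer from the background
`⟨U, b, x⁰, |x̲|⟩` to `⟨U, b', x⁰, |x̲|⟩`. Proof: pointwise on late slabs
`‖D^m dev'‖ₑ ≤ ‖D^m dev‖ₑ + ‖D^m(b − b')‖ₑ` (`deviationTransfer_enorm_iteratedFDeriv_le`), take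
sups, squeeze. [folklore] -/
theorem stub_deviationTransfer :
    ∀ (𝓢 : Spacetime.{0} 4) (U : Opens E4) (Φ : U → 𝓢.carrier) (b b' : E4 → E4 →L[ℝ] E4 →L[ℝ] ℝ) (w : ℝ → E4 → ℝ≥0∞) (κ : ℝ),
        ContMDiff 𝓘(ℝ, E4) (𝓡 4) ((⊤ : ℕ∞) : WithTop ℕ∞) Φ →
        (∀ x : U, ContDiffAt ℝ ((⊤ : ℕ∞) : WithTop ℕ∞) b' x.1) →
        (∃ T : ℝ, ∀ x : U, T < x.1 0 → ContDiffAt ℝ ((⊤ : ℕ∞) : WithTop ℕ∞) b x.1) →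
        Tendsto (fun t : ℝ ↦ ⨆ x ∈ {x : U | x.1 0 = t}, ⨆ (m : ℕ) (_ : m ≤ 3), ‖iteratedFDeriv ℝ m (fun y ↦ b y - b' y) x.1‖ₑ) atTop (𝓝 0) →
        Tendsto (fun t : ℝ ↦ ⨆ x ∈ {x : U | x.1 0 = t ∧ E4.spatialNorm x.1 ≤ κ * t}, ⨆ (m : ℕ) (_ : m ≤ 3), w t x.1 * ‖iteratedFDeriv ℝ m (fun y ↦ b y - b' y) x.1‖ₑ) atTop (𝓝 0) →
        Tendsto (fun t ↦ 𝓢.deviationCk (ModelBackground.mk U b (fun x ↦ x 0) E4.spatialNorm) Φ 3 t) atTop (𝓝 0) →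
        Tendsto (fun t : ℝ ↦ ⨆ x ∈ {x : U | x.1 0 = t ∧ E4.spatialNorm x.1 ≤ κ * t}, ⨆ (m : ℕ) (_ : m ≤ 3), w t x.1 * ‖iteratedFDeriv ℝ m (𝓢.deviationExtend (ModelBackground.mk U b (fun x ↦ x 0) E4.spatialNorm) Φ) x.1‖ₑ) atTop (𝓝 0) →
          Tendsto (fun t ↦ 𝓢.deviationCk (ModelBackground.mk U b' (fun x ↦ x 0) E4.spatialNorm) Φ 3 t) atTop (𝓝 0) ∧
          Tendsto (fun t : ℝ ↦ ⨆ x ∈ {x : U | x.1 0 = t ∧ E4.spatialNorm x.1 ≤ κ * t}, ⨆ (m : ℕ) (_ : m ≤ 3), w t x.1 * ‖iteratedFDeriv ℝ m (𝓢.deviationExtend (ModelBackground.mk U b' (fun x ↦ x 0) E4.spatialNorm) Φ) x.1‖ₑ) atTop (𝓝 0) := by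
  intro 𝓢 U Φ b b' w κ hΦ hb' hb hd hdw hdev hwt
  obtain ⟨T, hT⟩ := hb
  -- pointwise bound at late points of `U`
  have hpt : ∀ x : U, T < x.1 0 → ∀ m : ℕ,
      ‖iteratedFDeriv ℝ m
          (𝓢.deviationExtend (ModelBackground.mk U b' (fun x ↦ x 0) E4.spatialNorm) Φ) x.1‖ₑ ≤
        ‖iteratedFDeriv ℝ m
            (𝓢.deviationExtend (ModelBackground.mk U b (fun x ↦ x 0) E4.spatialNorm) Φ) x.1‖ₑ +
          ‖iteratedFDeriv ℝ m (fun y ↦ b y - b' y) x.1‖ₑ := fun x hx m ↦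
    deviationTransfer_enorm_iteratedFDeriv_le 𝓢 U hΦ b b' _ _ x (hT x hx) (hb' x) m
  refine ⟨?_, ?_⟩
  · -- unweighted `C³` clause on the `U`-slabs
    have hlim : Tendsto (fun t ↦
        𝓢.deviationCk (ModelBackground.mk U b (fun x ↦ x 0) E4.spatialNorm) Φ 3 t +
          ⨆ x ∈ {x : U | x.1 0 = t}, ⨆ (m : ℕ) (_ : m ≤ 3),
            ‖iteratedFDeriv ℝ m (fun y ↦ b y - b' y) x.1‖ₑ) atTop (𝓝 0) := by
      rw [← add_zero (0 : ℝ≥0∞)]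
      exact hdev.add hd
    refine tendsto_of_tendsto_of_tendsto_of_le_of_le' tendsto_const_nhds hlim
      (Eventually.of_forall fun _ ↦ zero_le) ?_
    filter_upwards [eventually_gt_atTop T] with t ht
    refine iSup₂_le fun m hm ↦ iSup₂_le fun z hz ↦ ?_
    obtain ⟨x, hx, rfl⟩ := hz
    have hx0 : x.1 0 = t := hx
    have hxT : T < x.1 0 := by
      rw [hx0]
      exact ht
    have hmem : (x : E4) ∈
        Subtype.val '' (ModelBackground.mk U b (fun x ↦ x 0) E4.spatialNorm).timeSlab t :=
      ⟨x, hx, rfl⟩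
    refine (hpt x hxT m).trans (add_le_add ?_ ?_)
    · exact enorm_iteratedFDeriv_le_supCkENorm hm hmem _
    · exact le_iSup₂_of_le x hx0 (le_iSup₂_of_le m hm le_rfl)
  · -- `w`-weighted clause on the cone slabs
    have hlim : Tendsto (fun t ↦
        (⨆ x ∈ {x : U | x.1 0 = t ∧ E4.spatialNorm x.1 ≤ κ * t}, ⨆ (m : ℕ) (_ : m ≤ 3),
          w t x.1 * ‖iteratedFDeriv ℝ m
            (𝓢.deviationExtend (ModelBackground.mk U b (fun x ↦ x 0) E4.spatialNorm) Φ) x.1‖ₑ) +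
          ⨆ x ∈ {x : U | x.1 0 = t ∧ E4.spatialNorm x.1 ≤ κ * t}, ⨆ (m : ℕ) (_ : m ≤ 3),
            w t x.1 * ‖iteratedFDeriv ℝ m (fun y ↦ b y - b' y) x.1‖ₑ) atTop (𝓝 0) := by
      rw [← add_zero (0 : ℝ≥0∞)]
      exact hwt.add hdw
    refine tendsto_of_tendsto_of_tendsto_of_le_of_le' tendsto_const_nhds hlim
      (Eventually.of_forall fun _ ↦ zero_le) ?_
    filter_upwards [eventually_gt_atTop T] with t ht
    refine iSup₂_le fun x hx ↦ iSup₂_le fun m hm ↦ ?_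
    have hxT : T < x.1 0 := by
      rw [hx.1]
      exact ht
    refine (mul_le_mul_right (hpt x hxT m) (w t x.1)).trans ?_
    rw [mul_add]
    exact add_le_add (le_iSup₂_of_le x hx (le_iSup₂_of_le m hm le_rfl))
      (le_iSup₂_of_le x hx (le_iSup₂_of_le m hm le_rfl))

end Summit.FinalStateConjecture.FinalStateConjecture.Cruxes.ModulatedKerrHandoff.PhotonRocketModulation

end
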